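import Literature.Probability.Process.BrownianVec
import Mathlib.Probability.Distributions.Gaussian.Real
import Mathlib.MeasureTheory.Measure.CharacteristicFunction.Basic
import HarnessLib

/-!
# The joint characteristic function of the increments of `d`-dimensional Brownian motion

Topic `Probability/Process`; theorems only. For a `d`-dimensional Brownian motion `W`
(`IsBrownianVec`, `BrownianVec`: weak Markov property at deterministic times, Gaussian marginals
`gaussVec d h = N(0, hI_d)`), ordered times `r₀ ≤ r₁ ≤ ⋯` and vectors `c_j ∈ ℝᵈ`:

* `integral_cexp_gaussVec` — `∫ exp(i c·x) dN(0, hI_d)(x) = exp(−h|c|²/2)` (product of the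
  one-dimensional Gaussian characteristic functions, Mathlib `charFun_gaussianReal`);
* `integral_mul_cexp_incr` — for a complex `𝓕_{r}`-measurable weight `G`,
  `E[G exp(i c·(W_{r+h} − W_r))] = E[G] exp(−h|c|²/2)` (independence of the increment from
  the past, `indep_comap_vecShift_natFiltration`, and its law, `map_incr`);
* `integral_cexp_sum_incr` — **`E[exp(i Σ_{j<n} c_j·(W_{r_{j+1}} − W_{r_j}))] =
  Π_{j<n} exp(−(r_{j+1} − r_j)|c_j|²/2)`**: the increments are independent centred Gaussian
  vectors (Le Gall (2016), Cor. 2.4 / Prop. 2.5; Kallenberg (2002), Thm. 13.4).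

## References

* J.-F. Le Gall, *Brownian Motion, Martingales, and Stochastic Calculus* (2016), Ch. 2,
  Prop. 2.5 and Cor. 2.4 (independent Gaussian increments). [Legall2016]
* O. Kallenberg, *Foundations of Modern Probability* (2002), Thm. 13.4.
-/

noncomputable section

open MeasureTheory ProbabilityTheory Filter Topology Set Complex
open scoped NNReal ENNReal BigOperators

namespace Literature.Probability.Process

variable {Ω : Type*} {mΩ : MeasurableSpace Ω} {P : Measure Ω} {d : ℕ} {W : ℝ≥0 → Ω → (Fin d → ℝ)}

/-- The Euclidean pairing `c · x = Σᵢ cᵢ xᵢ` on `ℝᵈ = Fin d → ℝ`. [folklore] -/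
theorem measurable_dotSum (c : Fin d → ℝ) : Measurable fun x : Fin d → ℝ ↦ ∑ i, c i * x i :=
  Finset.measurable_sum _ fun i _ ↦ (measurable_pi_apply i).const_mul _

/-- **The characteristic function of `N(0, h I_d)`**: `∫ exp(i c·x) dN(0, hI_d) = exp(−h|c|²/2)`.
[cite: Legall2016, Ch. 1 (Gaussian vectors)] -/
theorem integral_cexp_gaussVec (h : ℝ≥0) (c : Fin d → ℝ) :
    ∫ x, cexp (I * (∑ i, c i * x i : ℝ)) ∂gaussVec d h = cexp (-((h : ℝ) * (∑ i, c i ^ 2) / 2 : ℝ)) := by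
  have e1 : ∀ x : Fin d → ℝ, cexp (I * (∑ i, c i * x i : ℝ)) = ∏ i, cexp ((c i : ℂ) * (x i : ℂ) * I) := by
    intro x
    rw [← Complex.exp_sum]
    congr 1
    push_cast
    rw [Finset.mul_sum]
    refine Finset.sum_congr rfl fun i _ ↦ by ring
  simp_rw [e1]
  have hpi := integral_fintype_prod_eq_prod (𝕜 := ℂ) (f := fun i (x : ℝ) ↦ cexp ((c i : ℂ) * (x : ℂ) * I))
    (μ := fun _ : Fin d ↦ gaussianReal 0 h)
  rw [gaussVec, hpi]
  have e2 : ∀ i, ∫ x : ℝ, cexp ((c i : ℂ) * (x : ℂ) * I) ∂gaussianReal 0 h = cexp (-((h : ℝ) * c i ^ 2 / 2 : ℝ)) := by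
    intro i
    rw [← charFun_apply_real, charFun_gaussianReal]
    congr 1
    push_cast
    ring
  simp_rw [e2]
  rw [← Complex.exp_sum]
  congr 1
  push_cast
  rw [Finset.mul_sum, Finset.sum_div, ← Finset.sum_neg_distrib]

namespace IsBrownianVec

/-- **Independence of an increment from the past, tested against an exponential**: for a
complex `𝓕_r`-measurable weight `G` and `c ∈ ℝᵈ` (no integrability needed: both sides carry the
junk value together),
`E[G exp(i c·(W_{r+h} − W_r))] = E[G] · exp(−h|c|²/2)`. [cite: Legall2016, Prop. 2.5] -/
theorem integral_mul_cexp_incr [IsProbabilityMeasure P] (hW : IsBrownianVec W P) (r h : ℝ≥0)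
    (c : Fin d → ℝ) {G : Ω → ℂ} (hG : Measurable[hW.natFiltration r] G) :
    ∫ ω, G ω * cexp (I * (∑ i, c i * (W (r + h) ω - W r ω) i : ℝ)) ∂P =
      (∫ ω, G ω ∂P) * cexp (-((h : ℝ) * (∑ i, c i ^ 2) / 2 : ℝ)) := by
  have hle : hW.natFiltration r ≤ mΩ := hW.natFiltration.le r
  set ξ : Ω → (Fin d → ℝ) := fun ω ↦ W (r + h) ω - W r ω with hξ
  have hGm : Measurable G := hG.mono hle le_rfl
  have hξm : Measurable ξ := (hW.measurable (r + h)).sub (hW.measurable r)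
  -- independence of `G` (past) and `ξ` (increment)
  have hind : IndepFun G ξ P := by
    rw [IndepFun_iff_Indep]
    have h1 := (hW.indep_comap_vecShift_natFiltration r).symm
    refine indep_of_indep_of_le_right (indep_of_indep_of_le_left h1 ?_) ?_
    · exact hG.comap_le
    · exact (measurable_incr_comap r h).comap_le
  -- the law of the pair is the product of the laws
  have hprod := (indepFun_iff_map_prod_eq_prod_map_map hGm.aemeasurable hξm.aemeasurable).1 hind
  set ψ : (Fin d → ℝ) → ℂ := fun e ↦ cexp (I * (∑ i, c i * e i : ℝ)) with hψ
  have hψm : Measurable ψ := Complex.measurable_exp.comp (measurable_const.mul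
    (Complex.measurable_ofReal.comp (measurable_dotSum c)))
  have hpair : Measurable fun ω ↦ (G ω, ξ ω) := hGm.prodMk hξm
  have hFm : AEStronglyMeasurable (fun p : ℂ × (Fin d → ℝ) ↦ p.1 * ψ p.2)
      (P.map fun ω ↦ (G ω, ξ ω)) :=
    (measurable_fst.mul (hψm.comp measurable_snd)).aestronglyMeasurable
  calc ∫ ω, G ω * cexp (I * (∑ i, c i * (W (r + h) ω - W r ω) i : ℝ)) ∂P
      = ∫ ω, (fun p : ℂ × (Fin d → ℝ) ↦ p.1 * ψ p.2) (G ω, ξ ω) ∂P := rfl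
    _ = ∫ p, p.1 * ψ p.2 ∂(P.map fun ω ↦ (G ω, ξ ω)) := (integral_map hpair.aemeasurable hFm).symm
    _ = ∫ p, p.1 * ψ p.2 ∂((P.map G).prod (P.map ξ)) := by rw [hprod]
    _ = (∫ z, z ∂(P.map G)) * ∫ e, ψ e ∂(P.map ξ) := integral_prod_mul (fun z : ℂ ↦ z) ψ
    _ = (∫ ω, G ω ∂P) * ∫ e, ψ e ∂gaussVec d h := by
        rw [integral_map (f := fun z : ℂ ↦ z) hGm.aemeasurable
          (measurable_id' : Measurable fun z : ℂ ↦ z).aestronglyMeasurable, hξ, hW.map_incr r h]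
    _ = (∫ ω, G ω ∂P) * cexp (-((h : ℝ) * (∑ i, c i ^ 2) / 2 : ℝ)) := by rw [hψ, integral_cexp_gaussVec]

/-- **The joint characteristic function of the increments**: for ordered times
`r₀ ≤ r₁ ≤ ⋯` and `c_j ∈ ℝᵈ`,
`E[exp(i Σ_{j<n} c_j·(W_{r_{j+1}} − W_{r_j}))] = Π_{j<n} exp(−(r_{j+1} − r_j)|c_j|²/2)`.
[cite: Legall2016, Cor. 2.4 and Prop. 2.5] -/
theorem integral_cexp_sum_incr [IsProbabilityMeasure P] (hW : IsBrownianVec W P) {r : ℕ → ℝ≥0}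
    (hr : Monotone r) (c : ℕ → Fin d → ℝ) (n : ℕ) :
    ∫ ω, cexp (I * (∑ j ∈ Finset.range n, ∑ i, c j i * (W (r (j + 1)) ω - W (r j) ω) i : ℝ)) ∂P =
      ∏ j ∈ Finset.range n, cexp (-(((r (j + 1) : ℝ) - r j) * (∑ i, c j i ^ 2) / 2 : ℝ)) := by
  induction n with
  | zero => simp
  | succ n ih =>
    -- split off the last increment
    have hsplit : ∀ ω, cexp (I * (∑ j ∈ Finset.range (n + 1), ∑ i, c j i * (W (r (j + 1)) ω - W (r j) ω) i : ℝ)) =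
        cexp (I * (∑ j ∈ Finset.range n, ∑ i, c j i * (W (r (j + 1)) ω - W (r j) ω) i : ℝ)) *
          cexp (I * (∑ i, c n i * (W (r n + (r (n + 1) - r n)) ω - W (r n) ω) i : ℝ)) := by
      intro ω
      rw [← Complex.exp_add, Finset.sum_range_succ, add_tsub_cancel_of_le (hr (Nat.le_succ n))]
      congr 1
      push_cast
      ring
    simp_rw [hsplit]
    -- the first factor is `𝓕_{r n}`-measurable
    have hGm : Measurable[hW.natFiltration (r n)] fun ω ↦
        cexp (I * (∑ j ∈ Finset.range n, ∑ i, c j i * (W (r (j + 1)) ω - W (r j) ω) i : ℝ)) := by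
      refine Complex.measurable_exp.comp (measurable_const.mul (Complex.measurable_ofReal.comp ?_))
      refine Finset.measurable_sum _ fun j hj ↦ Finset.measurable_sum _ fun i _ ↦ ?_
      rw [Finset.mem_range] at hj
      have h1 : Measurable[hW.natFiltration (r n)] (W (r (j + 1))) := hW.measurable_apply_le (hr hj)
      have h2 : Measurable[hW.natFiltration (r n)] (W (r j)) := hW.measurable_apply_le (hr hj.le)
      exact ((measurable_pi_apply i).comp (h1.sub h2)).const_mul _
    rw [hW.integral_mul_cexp_incr (r n) (r (n + 1) - r n) (c n) hGm, ih, Finset.prod_range_succ]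
    congr 2
    rw [NNReal.coe_sub (hr (Nat.le_succ n))]

end IsBrownianVec

end Literature.Probability.Process

end
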